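import Mathlib
import HarnessLib
import Summits.HubbardSuperconductivity.HubbardSuperconductivity.Theorems.KLProgrammeKLRegimeEnginePairTransferSmearingBinomial
import Summits.HubbardSuperconductivity.HubbardSuperconductivity.Theorems.KLProgrammeKLRegimeEnginePairTransferRelResBase
import Summits.HubbardSuperconductivity.HubbardSuperconductivity.Theorems.KLProgrammeKLRegimeSplitEdgeFactsIdxLines

/-!
# Route `KLProgramme` — ENGINE child gen 8 (stmt-HubbardSuperconductivity-20437 `KLRegimeEngineV17F2`), skeleton v2 class #5 rev 3, Ẽ-organisation BASE (`n = 0`):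
# the base data FROM THE BINOMIAL–GRAM SMEARING BOUND — `transferBarRelIdx_floor_le`, `klmf_baseData_of_binomial`
# (cell gate-hubbard-kl, seat hubbard-kl-k3c1-p1 g12, technique «composed-map remainder propagation»; KLTC-INDEX §B′ BASE (i), scale-0 lane rows (i)/(ii))

WHY.  The BASE of the private relative-residue family (`pairTransferRelResIdx_zero_of_smearingBound`, p595017; clause `hbase` of `pairTransferStep7_of_analytic`) asks,
per pair `(s_{0,j} | s_{0,j′})` and class, for ONE smearing majorant `η ≥ ‖A°₀[s_{0,j}] − A°₀[s_{0,j′}]‖` on the bare ball and the budget row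
`η + mA²·Σ_c|t₀[s_j] − t₀[s_{j′}]|_c ≤ θ·Tb(0,j′)`.  Both are composed here from the scale-0 lane's two rows:
(i) the pinned kernel norms `N(m′)` of `H := e^{Δ_{softCovOf K₀ s_{0,j′}}}𝒱₀[K₀]` (even), (ii) a Gram constant `κ` of the `D`-line `softCovOf K₀ (s_{0,j} − s_{0,j′})`
(`= softCovOf K₀ s_{j′,j}`, `softSymbolCompl_sub_compl`) — through `klmf_memberAmplitude_sub_le_binomial` (p595226) — plus the weight mass `Σ_c|t₀[s_j] − t₀[s_{j′}]| ≤ 4·klIdxMass 0 j′`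
(`sum_abs_klTransferWeight_compl_sub_le`, p592960) and the bar's `k`-free floor:
* `transferBarRelIdx_floor_le` — `klIdxPrefactor r n·(KlamU)²·2⁻ⁿ·klIdxMass n m′ ≤ Tb(n,m′)(Qm,k,k′)` (every label);
* **`klmf_baseData_of_binomial`** — the `hbase`/`hdata` existential of the BASE door from (i), (ii), the two a priori rows and ONE NUMBER per depth `j′`:
  `(4!·|βL²|³)·Σ_{m′>2} C(2m′,4)κ^{2m′−4}N(m′) + 4·mA²·klIdxMass 0 j′ ≤ θ·r·(KlamU)²·klIdxMass 0 j′`.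
Composition over landed lemmas; the kernel norms, the Gram constant and the a priori size stay hypotheses; nothing asserts (X).3, (c), K3 or superconductivity.  0 kit · 0 lit.
-/

noncomputable section

namespace Summit.HubbardSuperconductivity.HubbardSuperconductivity.Theorems.KLRegimeSplit

set_option linter.dupNamespace false -- summit = problem name (single-conjunct summit), D-0017

open Finset Matrix Set Literature.MathematicalPhysics.QuantumLattice Literature.Probability.LatticeModels GrassmannAlgebra
open Summit.HubbardSuperconductivity.HubbardSuperconductivity.Theorems.KLProgrammeLegKernels
open Summit.HubbardSuperconductivity.HubbardSuperconductivity.Theorems.DispersionFlow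
open Summit.HubbardSuperconductivity.HubbardSuperconductivity.Theorems.KLRegimeWick
open Summit.HubbardSuperconductivity.HubbardSuperconductivity.Theorems.EngineV8

/-! ## §1 The bar's `k`-free floor -/

section Floor

variable {L : ℕ}

/-- **`transferBarRelIdx_floor_le`** — the value slot alone is below the bar: `klIdxPrefactor r n·(KlamU)²·2⁻ⁿ·klIdxMass n m′ ≤ transferBarRelIdx L G P r β U n m′ Qm k k′`
(`0 ≤ r`, `0 ≤ P.Klam`, `0 ≤ G.CF`; the sector gains, the `1/L`, overlap, cubic and thermal slots are nonnegative). -/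
theorem transferBarRelIdx_floor_le {G : GeoConsts} (hCF : 0 ≤ G.CF) {P : SplitConsts} (hKl : 0 ≤ P.Klam) {r : ℝ} (hr : 0 ≤ r) (β U : ℝ) (n m' : ℕ)
    (Qm k k' : TorusSite 2 L) :
    klIdxPrefactor r n * ((P.Klam * U) ^ 2 * (((2 : ℝ) ^ n)⁻¹ * klIdxMass n m')) ≤ transferBarRelIdx L G P r β U n m' Qm k k' := by
  rw [transferBarRelIdx_eq, transferBarRelAtWF_eq]
  have hρ := klIdxPrefactor_nonneg hr n
  have hms := klIdxMass_nonneg n m'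
  have hov := klIdxOverlap_nonneg n m'
  have hg1 : 0 ≤ klRelGain n (klTorusNorm L (k - k')) := klRelGain_nonneg n (torusSupNorm_nonneg _)
  have hg2 : 0 ≤ klRelGain n (klTorusNorm L (k + k' - Qm)) := klRelGain_nonneg n (torusSupNorm_nonneg _)
  have hth := thermalBar_nonneg' hCF P U β n
  have hK2 : 0 ≤ (P.Klam * U) ^ 2 := by positivity
  have hK3 : 0 ≤ (P.Klam * |U|) ^ 3 * ((2 : ℝ) ^ n)⁻¹ := by positivity
  have hL : 0 ≤ ((L : ℝ))⁻¹ := by positivity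
  have h4 : 0 ≤ ((4 : ℝ) ^ n)⁻¹ := by positivity
  refine mul_le_mul_of_nonneg_left ?_ hρ
  nlinarith [mul_nonneg hK2 (mul_nonneg (add_nonneg (add_nonneg hg1 hg2) hL) hms), mul_nonneg hK2 (mul_nonneg h4 hov),
    mul_nonneg (add_nonneg hK3 hth) hms]

end Floor

/-! ## §2 The BASE data from the binomial–Gram bound -/

section Base

variable (L M : ℕ) [NeZero L] [NeZero M]

set_option maxHeartbeats 800000 in -- composition with long model expressions
/-- **`klmf_baseData_of_binomial`** — for the pair `(s_{0,j} | s_{0,j′})`, `0 ≤ j′ ≤ j`, and class `Qm` at the bare frame `K₀ = klFlowFrameU … 0` (`FrameOK`, `klBetaMin ≤ β ≤ L`):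
the BASE existential of `pairTransferRelResIdx_zero_of_smearingBound` / `pairTransferStep7_of_analytic` at the bar `θ·transferBarRelIdx L G P r β U 0 j′` from
(i) the pinned kernel norms `N` of `H := e^{Δ_{softCovOf K₀ s_{0,j′}}}𝒱₀[K₀]` (even), (ii) `IsGramBoundedR (softCovOf K₀ (s_{0,j} − s_{0,j′})) κ`, the two a priori rows, and the
ONE-NUMBER budget `binomial(κ, N) + 4·mA²·klIdxMass 0 j′ ≤ θ·r·(KlamU)²·klIdxMass 0 j′`. -/
theorem klmf_baseData_of_binomial {R : RenConsts} {N₀ : ℕ} {G : GeoConsts} (hCF : 0 ≤ G.CF) {P : SplitConsts} (hKl : 0 ≤ P.Klam) {r : ℝ} (hr : 0 ≤ r)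
    {β U μ : ℝ} {mA θ : ℝ} (hm : 0 ≤ mA) (hθ0 : 0 ≤ θ)
    (hKf : FrameOK R U N₀ μ (klFlowFrameU L M β U μ 0)) (hβ : klBetaMin ≤ β) (hβL : β ≤ L)
    {j j' : ℕ} (hj : j' ≤ j) (Qm : TorusSite 2 L) {κ : ℝ} (hκ : 0 ≤ κ)
    (hGB : IsGramBoundedR (softCovOf L M β μ (klFlowFrameU L M β U μ 0) ((softSymbolCompl L M β μ (klFlowFrameU L M β U μ 0) 0 j) - (softSymbolCompl L M β μ (klFlowFrameU L M β U μ 0) 0 j'))) κ)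
    (hH : (gaussConv ℂ (softCovOf L M β μ (klFlowFrameU L M β U μ 0) (softSymbolCompl L M β μ (klFlowFrameU L M β U μ 0) 0 j')) (klEffectiveAction L M β U μ (klFlowFrameU L M β U μ 0) klE0 0)) ∈ evenPart ℂ (HubbardFieldIdx L M))
    (N : ℕ → ℝ) (hN0 : ∀ m', 0 ≤ N m')
    (hN : ∀ m' (i : Fin (2 * m')) (w : HubbardFieldIdx L M),
      ∑ Y ∈ univ.filter (fun Y : Fin (2 * m') → HubbardFieldIdx L M => Y i = w), ‖kernel ℂ (gaussConv ℂ (softCovOf L M β μ (klFlowFrameU L M β U μ 0) (softSymbolCompl L M β μ (klFlowFrameU L M β U μ 0) 0 j')) (klEffectiveAction L M β U μ (klFlowFrameU L M β U μ 0) klE0 0)) (2 * m') Y‖ ≤ N m')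
    (hA₁ : ∀ x y, ‖klMemberArrayF L M β U μ 0 (softSymbolCompl L M β μ (klFlowFrameU L M β U μ 0) 0 j) Qm x y‖ ≤ mA)
    (hA₂ : ∀ x y, ‖klMemberArrayF L M β U μ 0 (softSymbolCompl L M β μ (klFlowFrameU L M β U μ 0) 0 j') Qm x y‖ ≤ mA)
    (hbud : ((((2 * 2).factorial : ℝ) * |β * (L : ℝ) ^ 2| ^ (2 * 2 - 1)) *
          ∑ m' ∈ range (Fintype.card (HubbardFieldIdx L M) / 2 + 1),
            if 2 < m' then ((2 * m').choose (2 * 2) : ℝ) * κ ^ (2 * m' - 2 * 2) * N m' else 0) +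
        4 * (mA * mA) * klIdxMass 0 j' ≤ θ * (r * ((P.Klam * U) ^ 2 * klIdxMass 0 j'))) :
    ∃ η : TorusSite 2 L → TorusSite 2 L → ℝ,
      (∀ x y, ‖klMemberArrayF L M β U μ 0 (softSymbolCompl L M β μ (klFlowFrameU L M β U μ 0) 0 j) Qm x y‖ ≤ mA) ∧
      (∀ x y, ‖klMemberArrayF L M β U μ 0 (softSymbolCompl L M β μ (klFlowFrameU L M β U μ 0) 0 j') Qm x y‖ ≤ mA) ∧
      (∀ k ∈ klBall L μ 0, ∀ k' ∈ klBall L μ 0,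
        ‖(klMemberArrayF L M β U μ 0 (softSymbolCompl L M β μ (klFlowFrameU L M β U μ 0) 0 j) Qm - klMemberArrayF L M β U μ 0 (softSymbolCompl L M β μ (klFlowFrameU L M β U μ 0) 0 j') Qm) k k'‖ ≤ η k k') ∧
      (∀ k ∈ klBall L μ 0, ∀ k' ∈ klBall L μ 0, η k k' + mA * mA *
        ∑ c, ‖(-(((klTransferWeight L M β μ (klFlowFrameU L M β U μ 0) 0 (softSymbolCompl L M β μ (klFlowFrameU L M β U μ 0) 0 j) Qm c -
          klTransferWeight L M β μ (klFlowFrameU L M β U μ 0) 0 (softSymbolCompl L M β μ (klFlowFrameU L M β U μ 0) 0 j') Qm c : ℝ)) : ℂ))‖ ≤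
        θ * transferBarRelIdx L G P r β U 0 j' Qm k k') := by
  refine ⟨fun _ _ => ((((2 * 2).factorial : ℝ) * |β * (L : ℝ) ^ 2| ^ (2 * 2 - 1)) *
          ∑ m' ∈ range (Fintype.card (HubbardFieldIdx L M) / 2 + 1),
            if 2 < m' then ((2 * m').choose (2 * 2) : ℝ) * κ ^ (2 * m' - 2 * 2) * N m' else 0), hA₁, hA₂, fun k hk k' hk' => ?_, fun k hk k' hk' => ?_⟩
  · -- the smearing row: the binomial–Gram bound at the label tuple of `(k, k′)`
    rw [Matrix.sub_apply, klMemberArrayF_apply_of_mem β U μ 0 _ Qm hk hk', klMemberArrayF_apply_of_mem β U μ 0 _ Qm hk hk']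
    exact klmf_memberAmplitude_sub_le_binomial L M β U μ (klFlowFrameU L M β U μ 0) 0 _ _ hκ hGB hH N hN0 hN _
  · -- the budget row: weight mass `≤ 4·klIdxMass 0 j′` and the bar's floor at `n = 0`
    have hw : ∑ c, ‖(-(((klTransferWeight L M β μ (klFlowFrameU L M β U μ 0) 0 (softSymbolCompl L M β μ (klFlowFrameU L M β U μ 0) 0 j) Qm c -
          klTransferWeight L M β μ (klFlowFrameU L M β U μ 0) 0 (softSymbolCompl L M β μ (klFlowFrameU L M β U μ 0) 0 j') Qm c : ℝ)) : ℂ))‖ ≤ 4 * klIdxMass 0 j' := by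
      have h := sum_abs_klTransferWeight_compl_sub_le (M := M) β μ (klFlowFrameU L M β U μ 0) hKf hβ hβL (Nat.zero_le j') hj Qm
      refine le_of_eq_of_le ?_ h
      refine Finset.sum_congr rfl fun c _ => ?_
      rw [norm_neg, Complex.norm_real, Real.norm_eq_abs]
    have hfl := transferBarRelIdx_floor_le (L := L) hCF hKl hr β U 0 j' Qm k k'
    rw [klIdxPrefactor_zero, pow_zero, inv_one, one_mul] at hfl
    have hmm : 0 ≤ mA * mA := mul_nonneg hm hm
    have h1 := mul_le_mul_of_nonneg_left hw hmm
    have h2 := mul_le_mul_of_nonneg_left hfl hθ0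
    linarith

end Base

end Summit.HubbardSuperconductivity.HubbardSuperconductivity.Theorems.KLRegimeSplit

end
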